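import Summits.BirchSwinnertonDyer.BirchSwinnertonDyer.Theorems.SemiOrdinaryEisensteinDescentCasselsTateLemma615Bridge
import Summits.BirchSwinnertonDyer.BirchSwinnertonDyer.Theorems.ThetaPartnerAtTwoSignedControlAtTwoCasselsPTModKummerAt
import Summits.BirchSwinnertonDyer.BirchSwinnertonDyer.Theorems.KolyvaginRoadThreePTMilneTorsion
import HarnessLib

/-!
# The Lemma-6.15 input of the levelwise Cassels–Tate fact FOR THE CANONICAL INVARIANT MAPS, from Poitou–Tate AT ONE
# MODULE `E[m]` (Howard (i) shape) — route `SemiOrdinaryEisensteinDescent`, print debt `CasselsTateLevelInputsFact`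
# (item stmt-BirchSwinnertonDyer-20191, conjunct 1 of `KolyvaginPrimitivesAtThree` stmt-25896); width seat
# `bsd-wall-soed-p2-w3` g4 (`--supports stmt-BirchSwinnertonDyer-25898`, helper)

HONEST FRAMING. THEOREMS ONLY (no definition, no named fact, no `sorry`, no instance). Nothing here proves a case of
Poitou–Tate or of BSD; the crux J‴ of the Kolyvagin column is research and untouched. What this file does: of the FOUR
displayed residual inputs of `casselsTate_levelInputs K` for THE family `LocalInvariants.canonical K (m·m)`
(`casselsTate_levelInputs_of_canonical_inputs`, w2 g2: `hH3` = Milne I 4.10(c), `hPTc` = I 4.10(a) in cochain form, `h615` =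
the conclusion of Milne I Lemma 6.15 for all `S ⊇ S₀`, `hconj` = (v) `Aut(K/ℚ)`-equivariance), the Lemma-6.15 input `h615` is
DISCHARGED from Poitou–Tate duality AT THE ONE MODULE `E[m]`, `m = p^{M₀}`, `p` odd, in Howard's Thm. 2.1.11 (i) shape for THE
invariant maps at level `m` (`hSC`, verbatim the hypothesis `hcomplAt` of the tree's
`SignedEC.CasselsPT.exists_mem_kummerOutside_localization_sub_mem_of_selmerComplementAt`, tp2-p3-w3 g6) — hence from Milne I
4.10(b) `Ker γ¹ ⊆ Im β¹` for `E[m]` and THE maps (`…_of_middleExactAt`, via the tree's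
`PTAt.selmerComplementAt_canonical_of_middleExact`), which at `M₀ = 1` IS A THEOREM of the tree
(`KolyvaginRoadThreePT.middleExact_canonical_torsionGaloisModule`, koly g20): `lemma615Input_canonical_prime`.

THE BRIDGE (the only mathematics here, Milne I §6 proof of Prop. 6.9 / Serre *Corps locaux* XIII §3): the CT recipe pairs
`H¹(K_v, E[m])` with itself through the DESCENDED pairing `E[m] × E[m] → μ_{m²}` (`descendPairing`, values `e_{m²}(ι S, T̃)`,
`[m]T̃ = T`) read by `inv^{(m²)}_v`, whereas the kernel's Poitou–Tate AT `E[m]` lives at level `m`. Reading the descended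
pairing as a `μ_m`-valued Weil-type pairing `eD` at level `m` (`descFun_*`: `m`-th roots of unity, bilinear, `Γ_K`-equivariant,
alternating, non-degenerate) one has `ι_{m ⊆ m²} ∘ e_D = desc`, so the descended cup product is `H²(μ_m ⊆ μ_{m²})` of the
level-`m` Weil cup product, and the LEVEL COMPATIBILITY of THE invariant maps on LOCAL classes gives
`inv^{(m²)}_v(a ∪_desc b) = m · inv^{(m)}_v(a ∪_{eD} b)` in `ℤ/m²` — all in the companion file
`…CasselsTateLemma615Bridge.lean` (`descLocalPairing_canonical_eq`). Since
`a ↦ m·a : ℤ/m → ℤ/m²` is additive and injective, orthogonality for Milne's sum pairing at level `m²` is orthogonality for the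
level-`m` Weil sum pairing; at the infinite places `H¹(K_w, E[m]) = 0` (`m` odd). Then tp2-p3-w3 g6's per-module theorem (Howard
(i) for `kummerStrict ∅ ≤ kummerRelaxed S`, Tate's local Euler characteristic PROVED, `𝓛_v^⊥ = 𝓛_v`) yields the Lemma-6.15
conclusion with `S₀ = ∅`.

Main statements:
* `lemma615Input_canonical_of_selmerComplementAt` — at one curve `E/K`, one odd prime power `m = p^k`: the `h615` body for
  `LocalInvariants.canonical K (m·m)` and every finite `S`, from `hSC` (Howard (i) AT `E[m]`, level `m`, THE maps).
* `lemma615Input_canonical_of_middleExactAt` — the same from Milne I 4.10(b) AT `E[m]` (THE maps, all admissible `S ⊇ ∞`).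
* `lemma615Input_canonical_prime` — `k = 1`: UNCONDITIONAL (the tree's PT road at `E[p]`, `p` odd).
* `casselsTate_levelInputs_of_canonical_inputs_of_selmerComplementAt` — `casselsTate_levelInputs K`
  (the body of item 20191 at `K`) from {`hH3`, `hPTc`, `hconj`} and Poitou–Tate AT the modules `E[p^{M₀}]` ONLY: the Lemma-6.15
  residual is no longer an independent print input; it is the same per-module Milne I 4.10(b) statement that feeds the route's
  PT item 23092 and the TP2/KR3 per-module closers.

References: [MilneADT2006] I Cor. 2.3, Thm. 2.8, Thm. 4.10(b), §6 Prop. 6.9 (proof), Lemma 6.15; [SerreLocalFields1979] XIII §3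
Cor. 3 (compatibility of `inv` in the tower of levels); [Howard2004HeegnerKolyvagin] Thm. 2.1.11; [GreenbergLNM1716] §4 App.,
Prop. 4.13. BSD is not proved by any of this.
-/

noncomputable section

open scoped Classical

-- the Theorems namespace of this sub repeats the summit name by design (D-0017 nested layout)
set_option linter.dupNamespace false
set_option autoImplicit false

open CategoryTheory Field NumberField IsDedekindDomain Function
open Literature.NumberTheory.EllipticCurves Literature.NumberTheory.GaloisCohomology
  Literature.NumberTheory.GaloisRepresentations
open Literature.NumberTheory.GaloisRepresentations.DiscreteGaloisModule (mu MuCarrier SelmerStructure unramifiedSubgroup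
  localTatePairingZMod tateDual)
open _root_.WeierstrassCurve
open Summit.BirchSwinnertonDyer.Rank1Residual.X11b.Relaxation (invWeilPairing invWeilPairing_apply)

namespace Summit.BirchSwinnertonDyer.BirchSwinnertonDyer.Theorems.CasselsTateLemma615OfPT

/-! ## §4 Milne I Lemma 6.15 for THE invariant maps from Poitou–Tate AT `E[m]` -/

section Main

variable {K : Type} [Field K] [NumberField K] (W : WeierstrassCurve K) [W.IsElliptic] (p k : ℕ) [Fact p.Prime]
variable (e : geomTorsion W ((p ^ k * p ^ k : ℕ) : ℤ) → geomTorsion W ((p ^ k * p ^ k : ℕ) : ℤ) → AlgebraicClosure K)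
  (hμ : ∀ S T, e S T ^ (p ^ k * p ^ k) = 1)
  (hadd₁ : ∀ S₁ S₂ T, e (S₁ + S₂) T = e S₁ T * e S₂ T)
  (hadd₂ : ∀ S T₁ T₂, e S (T₁ + T₂) = e S T₁ * e S T₂)
  (hgal : ∀ (σ : absoluteGaloisGroup K) (S T : geomTorsion W ((p ^ k * p ^ k : ℕ) : ℤ)), σ • e S T = e (σ • S) (σ • T))
  (halt : ∀ T, e T T = 1) (hnd : ∀ T, (∀ S, e S T = 1) → T = 0)

include halt hnd in
/-- **The Lemma-6.15 input of the Cassels–Tate recipe FOR THE INVARIANT MAPS `LocalInvariants.canonical K (m·m)`, at one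
elliptic curve `E/K`, one ODD prime power `m = p^k` (`k ≥ 1`) and EVERY finite set of places `S`, from Poitou–Tate duality
AT THE ONE MODULE `E[m]` in Howard's Thm. 2.1.11 (i) shape for THE maps at level `m` (`hSC`).** If `x ∈ X_S = ∏_{v∈S} H¹(K_v, E[m])`
annihilates the localisations of `Sel^{(m)}(E/K)` under Milne's sum pairing `∑_{v∈S} inv^{(m²)}_v(· ∪_desc ·)`, then
`x ≡ loc_S b₀` modulo the local Kummer conditions for some `b₀ ∈ H¹(K, E[m])` with the Kummer condition off `S`. Proof: by
`descLocalPairing_canonical_eq` and the injectivity of `a ↦ m·a : ℤ/m → ℤ/m²`, the orthogonality is the level-`m` one for the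
Weil-type pairing `eD`; at the infinite places `H¹ = 0` (`m` odd) so the test classes of tp2-p3-w3 g6's
`exists_mem_kummerOutside_localization_sub_mem_of_selmerComplementAt` are Selmer classes; that theorem (Howard (i) at `E[m]`,
THE maps injective at finite places, Tate's local Euler characteristic) concludes.
[cite: MilneADT2006, Ch. I, Lemma 6.15] [cite: Howard2004HeegnerKolyvagin, Thm. 2.1.11] [cite: GreenbergLNM1716, §4 App., Prop. 4.13] -/
theorem lemma615Input_canonical_of_selmerComplementAt [NeZero (p ^ k)] [Finite (W.geomTorsion ((p ^ k : ℕ) : ℤ))]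
    (hp2 : p ≠ 2) (hk : 0 < k)
    (hSC : ∀ (S : Finset (Place K)),
      (∀ v : HeightOneSpectrum (𝓞 K), (Sum.inr v : Place K) ∉ S →
        ((p ^ k : ℕ) : 𝓞 K) ∉ v.asIdeal ∧ GaloisRep.IsUnramifiedAt v (W.torsionGaloisModule ((p ^ k : ℕ) : ℤ))) →
      ∀ (𝓕 𝓖 : SelmerStructure (W.torsionGaloisModule ((p ^ k : ℕ) : ℤ))), 𝓕 ≤ 𝓖 →
        𝓕.IsUnramifiedOutside S → 𝓖.IsUnramifiedOutside S →
        ∀ t : Π v : Place K, galoisCohomology ((W.torsionGaloisModule ((p ^ k : ℕ) : ℤ)).toLocal v) 1,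
          (∀ v ∈ S, t v ∈ 𝓖 v) →
          (∀ y ∈ ((LocalInvariants.canonical K (p ^ k)).dualSelmerStructure
              (W.torsionGaloisModule ((p ^ k : ℕ) : ℤ)) 𝓕).selmerGroup,
            ∑ v ∈ S, localTatePairingZMod (W.torsionGaloisModule ((p ^ k : ℕ) : ℤ)) (p ^ k) v
              (LocalInvariants.canonical K (p ^ k) v) (t v)
              (galoisCohomology.localization ((W.torsionGaloisModule ((p ^ k : ℕ) : ℤ)).tateDual (p ^ k)) v 1 y) = 0) →
          ∃ x ∈ 𝓖.selmerGroup, ∀ v ∈ S,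
            galoisCohomology.localization (W.torsionGaloisModule ((p ^ k : ℕ) : ℤ)) v 1 x - t v ∈ 𝓕 v)
    (S : Finset (Place K)) (x : LocalClasses W (p ^ k) S)
    (hx : ∀ b' ∈ W.selmerGroup ((p ^ k : ℕ) : ℤ),
      sumPairing W (p ^ k) e hμ hadd₁ hadd₂ hgal (LocalInvariants.canonical K (p ^ k * p ^ k)) S x
        (locS W (p ^ k) S b') = 0) :
    ∃ b₀ ∈ kummerOutside W (p ^ k) S, ∀ v : S,
      x v - locS W (p ^ k) S b₀ v ∈ W.kummerLocalConditionAt ((p ^ k : ℕ) : ℤ) (Place.Completion (v : Place K)) := by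
  classical
  have hp : p.Prime := Fact.out
  have hodd : Odd (p ^ k) := (hp.odd_of_ne_two hp2).pow
  -- the test family, extended by zero off `S`
  let t : Π v : Place K, galoisCohomology ((W.torsionGaloisModule ((p ^ k : ℕ) : ℤ)).toLocal v) 1 :=
    fun v => if h : v ∈ S then x ⟨v, h⟩ else 0
  have ht : ∀ v : S, t v = x v := fun v => by
    show (if h : (v : Place K) ∈ S then x ⟨v, h⟩ else 0) = x v
    rw [dif_pos v.2]
  -- tp2-p3-w3 g6's per-module theorem at level `m = p^k`, Weil-type pairing `eD`, THE maps
  have hinj : ∀ v : HeightOneSpectrum (𝓞 K), Injective (LocalInvariants.canonical K (p ^ k) (Sum.inr v)) := fun v => by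
    rw [LocalInvariants.canonical_inr]; exact (localInvariantMap_bijective v).1
  have key := SignedEC.CasselsPT.exists_mem_kummerOutside_localization_sub_mem_of_selmerComplementAt W p k
    (fun S T => ((muVal K (p ^ k * p ^ k) (descendHom W (p ^ k) (p ^ k) e hμ hadd₁ hadd₂ S T) : (AlgebraicClosure K)ˣ) :
      AlgebraicClosure K))
    (descFun_pow W (p ^ k) e hμ hadd₁ hadd₂) (descFun_add₁ W (p ^ k) e hμ hadd₁ hadd₂) (descFun_add₂ W (p ^ k) e hμ hadd₁ hadd₂)
    (descFun_smul W (p ^ k) e hμ hadd₁ hadd₂ hgal) (descFun_self W (p ^ k) e hμ hadd₁ hadd₂ halt)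
    (descFun_nondeg W (p ^ k) e hμ hadd₁ hadd₂ hnd) hk hinj hSC S t
  obtain ⟨x', hx', hx't⟩ := key (fun c hcfin _ => by
      -- the test class is a Selmer class (`H¹(K_w, E[m]) = 0` at the infinite places, `m` odd)
      have hcSel : c ∈ W.selmerGroup ((p ^ k : ℕ) : ℤ) := by
        refine (mem_selmerGroup_iff_forall_localization_mem W _ c).mpr ?_
        rintro (w | v)
        · rw [galoisCohomology_one_torsion_eq_zero_infinitePlace_of_odd W w ((Int.odd_coe_nat _).mpr hodd)
            (galoisCohomology.localization (W.torsionGaloisModule ((p ^ k : ℕ) : ℤ)) (Sum.inl w) 1 c)]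
          exact zero_mem _
        · exact hcfin v
      -- Milne's orthogonality at level `m²`, rewritten through the bridge
      have h0 := hx c hcSel
      rw [sumPairing_apply] at h0
      have h1 : ∑ v ∈ S, (((invWeilPairing W (p ^ k)
          (fun S T => ((muVal K (p ^ k * p ^ k) (descendHom W (p ^ k) (p ^ k) e hμ hadd₁ hadd₂ S T) :
            (AlgebraicClosure K)ˣ) : AlgebraicClosure K))
          (descFun_pow W (p ^ k) e hμ hadd₁ hadd₂) (descFun_add₁ W (p ^ k) e hμ hadd₁ hadd₂)
          (descFun_add₂ W (p ^ k) e hμ hadd₁ hadd₂) (descFun_smul W (p ^ k) e hμ hadd₁ hadd₂ hgal)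
          (LocalInvariants.canonical K (p ^ k)) v (t v)
          (galoisCohomology.localization (W.torsionGaloisModule ((p ^ k : ℕ) : ℤ)) v 1 c)).val * p ^ k : ℕ) :
            ZMod (p ^ k * p ^ k)) = 0 := by
        rw [← h0, ← Finset.sum_coe_sort S]
        refine Finset.sum_congr rfl fun v _ => ?_
        rw [← descLocalPairing_canonical_eq W (p ^ k) e hμ hadd₁ hadd₂ hgal hodd, ht v]
        rfl
      rw [← natCast_val_mul_sum] at h1
      exact eq_zero_of_natCast_val_mul_eq_zero (p ^ k) _ h1)
  refine ⟨x', hx', fun v => ?_⟩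
  have h := hx't (v : Place K) v.2
  rw [kummerSelmerStructure_apply, ht v] at h
  have h' := neg_mem h
  rwa [neg_sub] at h'

include halt hnd in
/-- **The same, from Milne I Thm. 4.10(b) `Ker γ¹ ⊆ Im β¹` AT THE ONE MODULE `E[m]` for THE invariant maps** (every finite `S`
containing the infinite places, off which `m` and `E[m]` are unramified) — the shape the Poitou–Tate lanes deliver per module;
Howard (i) at `E[m]` is the tree's `PTAt.selmerComplementAt_canonical_of_middleExact` (koly3b g10).
[cite: MilneADT2006, Ch. I, Thm. 4.10(b), Lemma 6.15] [cite: Howard2004HeegnerKolyvagin, Thm. 2.1.11] -/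
theorem lemma615Input_canonical_of_middleExactAt [NeZero (p ^ k)] [Finite (W.geomTorsion ((p ^ k : ℕ) : ℤ))]
    (hp2 : p ≠ 2) (hk : 0 < k)
    (hE : ∀ (S : Finset (Place K)), (∀ w : InfinitePlace K, (Sum.inl w : Place K) ∈ S) →
      (∀ v : HeightOneSpectrum (𝓞 K), (Sum.inr v : Place K) ∉ S →
        ((p ^ k : ℕ) : 𝓞 K) ∉ v.asIdeal ∧ GaloisRep.IsUnramifiedAt v (W.torsionGaloisModule ((p ^ k : ℕ) : ℤ))) →
      ∀ t : Π v : Place K, galoisCohomology ((W.torsionGaloisModule ((p ^ k : ℕ) : ℤ)).toLocal v) 1,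
        (∀ y : galoisCohomology ((W.torsionGaloisModule ((p ^ k : ℕ) : ℤ)).tateDual (p ^ k)) 1,
          (∀ v : HeightOneSpectrum (𝓞 K), (Sum.inr v : Place K) ∉ S →
            galoisCohomology.localization ((W.torsionGaloisModule ((p ^ k : ℕ) : ℤ)).tateDual (p ^ k)) (Sum.inr v) 1 y ∈
              unramifiedSubgroup (GaloisRep.toLocal v ((W.torsionGaloisModule ((p ^ k : ℕ) : ℤ)).tateDual (p ^ k))) 1) →
          ∑ v ∈ S, localTatePairingZMod (W.torsionGaloisModule ((p ^ k : ℕ) : ℤ)) (p ^ k) v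
            (LocalInvariants.canonical K (p ^ k) v) (t v)
            (galoisCohomology.localization ((W.torsionGaloisModule ((p ^ k : ℕ) : ℤ)).tateDual (p ^ k)) v 1 y) = 0) →
        ∃ x : galoisCohomology (W.torsionGaloisModule ((p ^ k : ℕ) : ℤ)) 1,
          (∀ v : HeightOneSpectrum (𝓞 K), (Sum.inr v : Place K) ∉ S →
            galoisCohomology.localization (W.torsionGaloisModule ((p ^ k : ℕ) : ℤ)) (Sum.inr v) 1 x ∈
              unramifiedSubgroup (GaloisRep.toLocal v (W.torsionGaloisModule ((p ^ k : ℕ) : ℤ))) 1) ∧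
          ∀ v ∈ S, galoisCohomology.localization (W.torsionGaloisModule ((p ^ k : ℕ) : ℤ)) v 1 x = t v)
    (S : Finset (Place K)) (x : LocalClasses W (p ^ k) S)
    (hx : ∀ b' ∈ W.selmerGroup ((p ^ k : ℕ) : ℤ),
      sumPairing W (p ^ k) e hμ hadd₁ hadd₂ hgal (LocalInvariants.canonical K (p ^ k * p ^ k)) S x
        (locS W (p ^ k) S b') = 0) :
    ∃ b₀ ∈ kummerOutside W (p ^ k) S, ∀ v : S,
      x v - locS W (p ^ k) S b₀ v ∈ W.kummerLocalConditionAt ((p ^ k : ℕ) : ℤ) (Place.Completion (v : Place K)) := by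
  have hp : p.Prime := Fact.out
  have hM : ∀ P : W.geomTorsion ((p ^ k : ℕ) : ℤ), (p ^ k) • P = 0 := fun P => Subtype.ext (by
    have h := (mem_geomTorsion_iff W ((p ^ k : ℕ) : ℤ) (P : geomPoints W)).mp P.2
    rw [natCast_zsmul] at h
    exact h)
  exact lemma615Input_canonical_of_selmerComplementAt W p k e hμ hadd₁ hadd₂ hgal halt hnd hp2 hk
    (fun S hS 𝓕 𝓖 hle h𝓕 h𝓖 =>
      (Summit.BirchSwinnertonDyer.Rank1Residual.X11b.Three.Koly.PTAt.selmerComplementAt_canonical_of_middleExact (p ^ k)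
        ⟨p, k, hp.prime, hk, rfl⟩ (W.torsionGaloisModule ((p ^ k : ℕ) : ℤ)) hM hE S hS 𝓕 𝓖 hle h𝓕 h𝓖).1)
    S x hx

end Main

/-! ## §5 The first level unconditionally: `m = p` an odd prime (the tree's PT road at `E[p]`, koly g20) -/

section Prime

variable {K : Type} [Field K] [NumberField K] (W : WeierstrassCurve K) [W.IsElliptic] (p : ℕ) [Fact p.Prime]

/-- **Howard (i) AT `E[q]` for THE invariant maps at any level `q` EQUAL to an odd prime `p`, unconditionally** — the tree's
`KolyvaginRoadThreePT.selmerComplementAt_canonical_torsionGaloisModule` (Milne I 4.10(b) for `E[p]`, `#E[p] = p²`, koly g20)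
transported along `p = q` (stated with a level variable so that it instantiates at `q = p ^ 1`, the first level of the
Cassels–Tate fact, where `p ^ 1` and `p` are not syntactically equal).
[cite: MilneADT2006, Ch. I, Thm. 4.10(b)] [cite: Howard2004HeegnerKolyvagin, Thm. 2.1.11] -/
theorem selmerComplementAtFst_canonical_torsion_of_eq_prime (hp2 : p ≠ 2) (q : ℕ) (hq : p = q) [NeZero q]
    [Finite (W.geomTorsion ((q : ℕ) : ℤ))] :
    ∀ (S : Finset (Place K)),
      (∀ v : HeightOneSpectrum (𝓞 K), (Sum.inr v : Place K) ∉ S →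
        ((q : ℕ) : 𝓞 K) ∉ v.asIdeal ∧ GaloisRep.IsUnramifiedAt v (W.torsionGaloisModule ((q : ℕ) : ℤ))) →
      ∀ (𝓕 𝓖 : SelmerStructure (W.torsionGaloisModule ((q : ℕ) : ℤ))), 𝓕 ≤ 𝓖 →
        𝓕.IsUnramifiedOutside S → 𝓖.IsUnramifiedOutside S →
        ∀ t : Π v : Place K, galoisCohomology ((W.torsionGaloisModule ((q : ℕ) : ℤ)).toLocal v) 1,
          (∀ v ∈ S, t v ∈ 𝓖 v) →
          (∀ y ∈ ((LocalInvariants.canonical K q).dualSelmerStructure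
              (W.torsionGaloisModule ((q : ℕ) : ℤ)) 𝓕).selmerGroup,
            ∑ v ∈ S, localTatePairingZMod (W.torsionGaloisModule ((q : ℕ) : ℤ)) q v
              (LocalInvariants.canonical K q v) (t v)
              (galoisCohomology.localization ((W.torsionGaloisModule ((q : ℕ) : ℤ)).tateDual q) v 1 y) = 0) →
          ∃ x ∈ 𝓖.selmerGroup, ∀ v ∈ S,
            galoisCohomology.localization (W.torsionGaloisModule ((q : ℕ) : ℤ)) v 1 x - t v ∈ 𝓕 v := by
  subst hq
  have hp : p.Prime := Fact.out
  intro S hS 𝓕 𝓖 hle h𝓕 h𝓖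
  exact (KolyvaginRoadThreePT.selmerComplementAt_canonical_torsionGaloisModule W (hp.odd_of_ne_two hp2) S hS 𝓕 𝓖 hle
    h𝓕 h𝓖).1

variable (e : geomTorsion W ((p ^ 1 * p ^ 1 : ℕ) : ℤ) → geomTorsion W ((p ^ 1 * p ^ 1 : ℕ) : ℤ) → AlgebraicClosure K)
  (hμ : ∀ S T, e S T ^ (p ^ 1 * p ^ 1) = 1)
  (hadd₁ : ∀ S₁ S₂ T, e (S₁ + S₂) T = e S₁ T * e S₂ T)
  (hadd₂ : ∀ S T₁ T₂, e S (T₁ + T₂) = e S T₁ * e S T₂)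
  (hgal : ∀ (σ : absoluteGaloisGroup K) (S T : geomTorsion W ((p ^ 1 * p ^ 1 : ℕ) : ℤ)), σ • e S T = e (σ • S) (σ • T))
  (halt : ∀ T, e T T = 1) (hnd : ∀ T, (∀ S, e S T = 1) → T = 0)

include halt hnd in
/-- **The Lemma-6.15 input of the Cassels–Tate recipe at the FIRST level `M₀ = 1` (`m = p ^ 1`, `p` an odd prime) for THE
invariant maps holds UNCONDITIONALLY**, for every elliptic curve over every number field and every finite `S`: the `h615` body
of `casselsTate_levelInputs_of_canonical_inputs` at `(W, p, 1)`, from the tree's Poitou–Tate road at `E[p]` (koly g20) through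
this file's bridge. (The levels `M₀ ≥ 2` wait for Milne I 4.10(b) at `E[p^{M₀}]`: `lemma615Input_canonical_of_middleExactAt`.)
[cite: MilneADT2006, Ch. I, Thm. 4.10(b), Lemma 6.15] -/
theorem lemma615Input_canonical_prime [NeZero (p ^ 1)] (hp2 : p ≠ 2) (S : Finset (Place K))
    (x : LocalClasses W (p ^ 1) S)
    (hx : ∀ b' ∈ W.selmerGroup ((p ^ 1 : ℕ) : ℤ),
      sumPairing W (p ^ 1) e hμ hadd₁ hadd₂ hgal (LocalInvariants.canonical K (p ^ 1 * p ^ 1)) S x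
        (locS W (p ^ 1) S b') = 0) :
    ∃ b₀ ∈ kummerOutside W (p ^ 1) S, ∀ v : S,
      x v - locS W (p ^ 1) S b₀ v ∈ W.kummerLocalConditionAt ((p ^ 1 : ℕ) : ℤ) (Place.Completion (v : Place K)) := by
  haveI : Finite (W.geomTorsion ((p ^ 1 : ℕ) : ℤ)) := finite_geomTorsion_of_neZero W (p ^ 1)
  exact lemma615Input_canonical_of_selmerComplementAt W p 1 e hμ hadd₁ hadd₂ hgal halt hnd hp2 Nat.one_pos
    (selmerComplementAtFst_canonical_torsion_of_eq_prime W p hp2 (p ^ 1) (pow_one p).symm) S x hx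

end Prime

/-! ## §6 The levelwise Cassels–Tate fact for THE maps with its Lemma-6.15 input discharged from per-module Poitou–Tate -/

section Fact615

/-- **`casselsTate_levelInputs K` (item stmt-BirchSwinnertonDyer-20191's body at `K`) from {`hH3`, `hPTc`, `hconj`} and
Poitou–Tate duality AT THE MODULES `E[p^{M₀}]` only** (Howard (i) shape for THE maps at level `p^{M₀}`, `hSC`): the tree's
`casselsTate_levelInputs_of_canonical_inputs` (w2 g2) with its `h615` binder supplied by
`lemma615Input_canonical_of_selmerComplementAt` (`S₀ = ∅`). CONDITIONAL on the displayed hypotheses; nothing else is asserted.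
[cite: MilneADT2006, Ch. I Cor. 2.3, Thm. 4.10(a)(b)(c), §6 Prop. 6.9, Thm. 6.13(a)(b), Lemma 6.15]
[cite: Howard2004HeegnerKolyvagin, Thm. 2.1.11] [cite: McCallumLMS1991, §5, Thm. 5.4, Thm. 5.8] -/
theorem casselsTate_levelInputs_of_canonical_inputs_of_selmerComplementAt (K : Type) [Field K] [NumberField K]
    (hH3 : ∀ (n : ℕ) [NeZero n] (x : galoisCohomology (mu K n) 3),
      (∀ v : Place K, galoisCohomology.localization (mu K n) v 3 x = 0) → x = 0)
    (hPTc : ∀ (W : WeierstrassCurve ℚ) [W.IsElliptic] (p M₀ : ℕ), p.Prime → p ≠ 2 → 1 ≤ M₀ →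
      ∀ [NeZero (p ^ M₀)]
        (e : geomTorsion (W.baseChange K) ((p ^ M₀ * p ^ M₀ : ℕ) : ℤ) →
          geomTorsion (W.baseChange K) ((p ^ M₀ * p ^ M₀ : ℕ) : ℤ) → AlgebraicClosure K)
        (hμ : ∀ S T, e S T ^ (p ^ M₀ * p ^ M₀) = 1)
        (hadd₁ : ∀ S₁ S₂ T, e (S₁ + S₂) T = e S₁ T * e S₂ T)
        (hadd₂ : ∀ S T₁ T₂, e S (T₁ + T₂) = e S T₁ * e S T₂)
        (hgal : ∀ (σ : absoluteGaloisGroup K)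
          (S T : geomTorsion (W.baseChange K) ((p ^ M₀ * p ^ M₀ : ℕ) : ℤ)), σ • e S T = e (σ • S) (σ • T)),
        (∀ T, e T T = 1) → (∀ T, (∀ S, e S T = 1) → T = 0) →
        ∀ f : contTwoCocycles ((W.baseChange K).torsionGaloisModule ((p ^ M₀ : ℕ) : ℤ)).toTopRep,
          (∀ g : contOneCocycles ((W.baseChange K).torsionGaloisModule ((p ^ M₀ : ℕ) : ℤ)).toTopRep,
            (∀ v : Place K, locClass ((W.baseChange K).torsionGaloisModule ((p ^ M₀ : ℕ) : ℤ))
                (Place.Completion v)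
                (resOne ((W.baseChange K).torsionGaloisModule ((p ^ M₀ : ℕ) : ℤ)) (Place.Completion v) g) = 0) →
            ∃ (C : PTChoice (W.baseChange K) (p ^ M₀) e hμ hadd₁ hadd₂ hgal f g) (S : Finset (Place K)),
              (∀ v ∉ S, C.localTerm (LocalInvariants.canonical K (p ^ M₀ * p ^ M₀)) v = 0) ∧
                ∑ v ∈ S, C.localTerm (LocalInvariants.canonical K (p ^ M₀ * p ^ M₀)) v = 0) →
          twoCocycleClass _ f = 0)
    (hSC : ∀ (W : WeierstrassCurve ℚ) [W.IsElliptic] (p M₀ : ℕ), p.Prime → p ≠ 2 → 1 ≤ M₀ →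
      ∀ [NeZero (p ^ M₀)] [Finite ((W.baseChange K).geomTorsion ((p ^ M₀ : ℕ) : ℤ))] (S : Finset (Place K)),
      (∀ v : HeightOneSpectrum (𝓞 K), (Sum.inr v : Place K) ∉ S →
        ((p ^ M₀ : ℕ) : 𝓞 K) ∉ v.asIdeal ∧
          GaloisRep.IsUnramifiedAt v ((W.baseChange K).torsionGaloisModule ((p ^ M₀ : ℕ) : ℤ))) →
      ∀ (𝓕 𝓖 : SelmerStructure ((W.baseChange K).torsionGaloisModule ((p ^ M₀ : ℕ) : ℤ))), 𝓕 ≤ 𝓖 →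
        𝓕.IsUnramifiedOutside S → 𝓖.IsUnramifiedOutside S →
        ∀ t : Π v : Place K, galoisCohomology (((W.baseChange K).torsionGaloisModule ((p ^ M₀ : ℕ) : ℤ)).toLocal v) 1,
          (∀ v ∈ S, t v ∈ 𝓖 v) →
          (∀ y ∈ ((LocalInvariants.canonical K (p ^ M₀)).dualSelmerStructure
              ((W.baseChange K).torsionGaloisModule ((p ^ M₀ : ℕ) : ℤ)) 𝓕).selmerGroup,
            ∑ v ∈ S, localTatePairingZMod ((W.baseChange K).torsionGaloisModule ((p ^ M₀ : ℕ) : ℤ)) (p ^ M₀) v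
              (LocalInvariants.canonical K (p ^ M₀) v) (t v)
              (galoisCohomology.localization
                (((W.baseChange K).torsionGaloisModule ((p ^ M₀ : ℕ) : ℤ)).tateDual (p ^ M₀)) v 1 y) = 0) →
          ∃ x ∈ 𝓖.selmerGroup, ∀ v ∈ S,
            galoisCohomology.localization ((W.baseChange K).torsionGaloisModule ((p ^ M₀ : ℕ) : ℤ)) v 1 x - t v ∈ 𝓕 v)
    (hconj : ∀ (W : WeierstrassCurve ℚ) [W.IsElliptic] (p M₀ : ℕ), p.Prime → p ≠ 2 → 1 ≤ M₀ →
      ∀ [NeZero (p ^ M₀)] (c : K ≃ₐ[ℚ] K), c ≠ 1 → c * c = 1 →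
      ∀ (e : geomTorsion (W.baseChange K) ((p ^ M₀ * p ^ M₀ : ℕ) : ℤ) →
          geomTorsion (W.baseChange K) ((p ^ M₀ * p ^ M₀ : ℕ) : ℤ) → AlgebraicClosure K)
        (hμ : ∀ S T, e S T ^ (p ^ M₀ * p ^ M₀) = 1)
        (hadd₁ : ∀ S₁ S₂ T, e (S₁ + S₂) T = e S₁ T * e S₂ T)
        (hadd₂ : ∀ S T₁ T₂, e S (T₁ + T₂) = e S T₁ * e S T₂)
        (hgal : ∀ (σ : absoluteGaloisGroup K)
          (S T : geomTorsion (W.baseChange K) ((p ^ M₀ * p ^ M₀ : ℕ) : ℤ)), σ • e S T = e (σ • S) (σ • T)),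
        (∀ T, e T T = 1) → (∀ T, (∀ S, e S T = 1) → T = 0) →
        ∀ z ∈ selmerGroup (W.baseChange K) ((p ^ M₀ * p ^ M₀ : ℕ) : ℤ),
          ∀ t ∈ selmerGroup (W.baseChange K) ((p ^ M₀ * p ^ M₀ : ℕ) : ℤ),
          ctGeneralFun (W.baseChange K) (p ^ M₀) e hμ hadd₁ hadd₂ hgal
              (LocalInvariants.canonical K (p ^ M₀ * p ^ M₀))
              (torsionH1ToH1 (W.baseChange K) _ (conjAct W c _ z))
              (torsionH1ToH1 (W.baseChange K) _ (conjAct W c _ t)) =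
            ctGeneralFun (W.baseChange K) (p ^ M₀) e hμ hadd₁ hadd₂ hgal
              (LocalInvariants.canonical K (p ^ M₀ * p ^ M₀))
              (torsionH1ToH1 (W.baseChange K) _ z) (torsionH1ToH1 (W.baseChange K) _ t)) :
    casselsTate_levelInputs K :=
  casselsTate_levelInputs_of_canonical_inputs K hH3 hPTc
    (fun W _ p M₀ hp hp2 hM₀ _ e hμ hadd₁ hadd₂ hgal halt hnd => ⟨∅, fun S _ x hx => by
      haveI : Fact p.Prime := ⟨hp⟩
      haveI : Finite ((W.baseChange K).geomTorsion ((p ^ M₀ : ℕ) : ℤ)) :=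
        finite_geomTorsion_of_neZero (W.baseChange K) (p ^ M₀)
      exact lemma615Input_canonical_of_selmerComplementAt (W.baseChange K) p M₀ e hμ hadd₁ hadd₂ hgal halt hnd hp2 hM₀
        (hSC W p M₀ hp hp2 hM₀) S x hx⟩)
    hconj

end Fact615

end Summit.BirchSwinnertonDyer.BirchSwinnertonDyer.Theorems.CasselsTateLemma615OfPT

end
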